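import Literature.Computability.Complexity.ScaledPCPParamsFP
import HarnessLib

/-!
# The random tape of the scaled PCP verifier as residues, in polynomial time

Literature / complexity toolkit, second MACHINE-LAYER brick for the spec-level verifier
`ScaledPCP.verifier' M T` of `ScaledPCPVerifier.lean` (after `ScaledPCPParamsFP.lean`, the
parameters). The verifier cuts its coin string into `kF n` blocks of `bN n` bits, accepts
outright if some block value is not below `p ⌊2ᵇ/p⌋` (`PCPCoins.Good`, so that the decoded
field elements are exactly uniform), and otherwise reads the structured tape
`tapeOf x ρ = tapeEquiv (PCPCoins.dec p b k ρ)` (`ρ ∈ 𝔽ᴷ`, the seed, the challenges `r ∈ 𝔽ᴷ`, the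
`Tt` test pairs, the direction of every read). This file gives that tape as LISTS OF RESIDUES
(natural numbers below `p`, `ZMod.val` of the field elements), proves the correspondence with the
structured tape, and computes everything in the typed algebra `CodeFP`:

* the residue tape is the parse `coinParse b p k ρ` of `CodeFPFieldSetup.lean` (flag = `PCPCoins.Good`,
  residues = block values mod `p`): `length_coinParse_snd`, `coinParse_snd_lt`,
  `val_dec : (dec p b k ρ j).val = (coinParse b p k ρ).2[j]`;
* the components `rhoN`, `seedN`, `rN`, `testX`, `testT`, `dirN` of a residue tape and their
  bridges `val_rho`, `val_seed`, `val_r`, `val_testX`, `val_testT`, `val_dirs` to the fields of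
  `tapeEquiv` (through `splitVec_fst/snd`, `chunkVec_apply`);
* the slicing programmes `rhoNC`, `seedNC`, `rNC`, `testXC`, `testTC`, `dirNC` (the parse itself
  is `CodeFP.coinParseCode` of `CodeFPFieldSetup.lean`).

All proved; no machine beyond the typed combinators; no named fact.

## References

* S. Arora, B. Barak, *Computational Complexity: A Modern Approach*, CUP 2009, §7.1 and Lemma A.31
  (field elements from coin blocks), Def. 11.4 [AroraBarakCC2009].
* L. Babai, L. Fortnow, L. Levin, M. Szegedy, *Checking computations in polylogarithmic time*,
  STOC 1991, §5 (the verifier's random field elements) [BFLS1991].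
-/

noncomputable section

open Polynomial

namespace Literature.Computability.Complexity

namespace ScaledPCP

open CodeFP Turing Tableau TableauCSP AlgebraicPCP _root_.Computability

attribute [local instance] Turing.FinTM2.kFin Turing.FinTM2.ΛFin Turing.FinTM2.σFin
  Turing.FinTM2.Γk₀Fin

/-! ### The residue tape: the parse of the coin blocks -/

/-- Length of the residue tape. [folklore] -/
@[simp] theorem length_coinParse_snd (b p k : ℕ) (ρ : List Bool) : (coinParse b p k ρ).2.length = k := by
  simp [coinParse_snd]

/-- Entries of the residue tape are reduced. [folklore] -/
theorem coinParse_snd_lt {p : ℕ} (hp : 0 < p) (b k : ℕ) (ρ : List Bool) : ∀ a ∈ (coinParse b p k ρ).2, a < p := by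
  intro a ha
  rw [coinParse_snd] at ha
  obtain ⟨v, -, rfl⟩ := List.mem_map.1 ha
  exact Nat.mod_lt _ hp

/-- **The `val` of a decoded field element is the residue of the parse.** [folklore] -/
theorem val_dec {p : ℕ} [NeZero p] (b k : ℕ) (ρ : List Bool) (j : Fin k) :
    (PCPCoins.dec p b k ρ j).val = (coinParse b p k ρ).2.getD (j : ℕ) 0 := by
  have hlt : (coinParse b p k ρ).2.getD (j : ℕ) 0 < p := by
    rw [coinParse_snd, List.getD_eq_getElem _ _ (by simp)]
    simp only [List.getElem_map, List.getElem_range]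
    exact Nat.mod_lt _ (Nat.pos_of_ne_zero (NeZero.ne p))
  rw [← coinParse_snd_getD b p k ρ j.2, ZMod.val_natCast, Nat.mod_eq_of_lt hlt]

/-! ### Components of a residue tape -/

section Comp

variable (K m Tt : ℕ)

/-- `ρ`: the first `K` residues. [folklore] -/
def rhoN (tv : List ℕ) : List ℕ := tv.take K

/-- The seed: residue `K`. [folklore] -/
def seedN (tv : List ℕ) : ℕ := tv.getD K 0

/-- The challenges `r`: residues `K+1, …, 2K`. [folklore] -/
def rN (tv : List ℕ) : List ℕ := (tv.drop (K + 1)).take K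

/-- The base point of test `i`. [folklore] -/
def testX (tv : List ℕ) (i : ℕ) : List ℕ := (tv.drop (K + 1 + K + (m + m) * i)).take m

/-- The direction of test `i`. [folklore] -/
def testT (tv : List ℕ) (i : ℕ) : List ℕ := (tv.drop (K + 1 + K + (m + m) * i + m)).take m

/-- The self-correction direction of the `q`-th read. [folklore] -/
def dirN (tv : List ℕ) (q : ℕ) : List ℕ := (tv.drop (K + 1 + K + Tt * (m + m) + m * q)).take m

end Comp

/-! ### Bridges to the structured tape -/

section Bridge

variable {F : Type} [Field F] {K m : ℕ} (C : CSP F K m) (Tt : ℕ)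

/-- `ρ` of the structured tape. [folklore] -/
theorem tapeEquiv_rho (v : Fin (nTape C Tt) → F) (t : Fin K) : (tapeEquiv C Tt v).ρ t = v ⟨t, by unfold nTape; omega⟩ := by
  show (splitVec K _ v).1 t = _
  rw [splitVec_fst]
  rfl

/-- The seed of the structured tape. [folklore] -/
theorem tapeEquiv_seed (v : Fin (nTape C Tt) → F) : (tapeEquiv C Tt v).seed = v ⟨K, by unfold nTape; omega⟩ := by
  show (splitVec 1 _ (splitVec K _ v).2).1 default = _
  rw [splitVec_fst, splitVec_snd]
  rfl

/-- `r` of the structured tape. [folklore] -/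
theorem tapeEquiv_r (v : Fin (nTape C Tt) → F) (t : Fin K) : (tapeEquiv C Tt v).r t = v ⟨K + 1 + t, by unfold nTape; omega⟩ := by
  show (splitVec K _ (splitVec 1 _ (splitVec K _ v).2).2).1 t = _
  rw [splitVec_fst, splitVec_snd, splitVec_snd]
  congr 1
  exact Fin.ext (by simp [Fin.natAdd, Fin.castAdd]; ring)

/-- Base point of test `i` of the structured tape. [folklore] -/
theorem tapeEquiv_testX (v : Fin (nTape C Tt) → F) (i : Fin Tt) (u : Fin m) :
    ((tapeEquiv C Tt v).tests i).1 u = v ⟨K + 1 + K + (m + m) * i + u, by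
      unfold nTape; have := i.2; have := u.2; nlinarith⟩ := by
  show (splitVec m m (chunkVec Tt (m + m) (splitVec (Tt * (m + m)) _ (splitVec K _ (splitVec 1 _ (splitVec K _ v).2).2).2).1 i)).1 u = _
  rw [splitVec_fst, chunkVec_apply, splitVec_fst, splitVec_snd, splitVec_snd, splitVec_snd]
  congr 1
  exact Fin.ext (by simp [Fin.natAdd, Fin.castAdd]; ring)

/-- Direction of test `i` of the structured tape. [folklore] -/
theorem tapeEquiv_testT (v : Fin (nTape C Tt) → F) (i : Fin Tt) (u : Fin m) :
    ((tapeEquiv C Tt v).tests i).2 u = v ⟨K + 1 + K + (m + m) * i + m + u, by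
      unfold nTape; have := i.2; have := u.2; nlinarith⟩ := by
  show (splitVec m m (chunkVec Tt (m + m) (splitVec (Tt * (m + m)) _ (splitVec K _ (splitVec 1 _ (splitVec K _ v).2).2).2).1 i)).2 u = _
  rw [splitVec_snd, chunkVec_apply, splitVec_fst, splitVec_snd, splitVec_snd, splitVec_snd]
  congr 1
  exact Fin.ext (by simp [Fin.natAdd, Fin.castAdd]; ring)

/-- Direction of a read of the structured tape. [folklore] -/
theorem tapeEquiv_dirs (v : Fin (nTape C Tt) → F) (q : C.Qry) (u : Fin m) :
    (tapeEquiv C Tt v).dirs q u = v ⟨K + 1 + K + Tt * (m + m) + m * (qryEquiv C q) + u, by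
      unfold nTape; have := (qryEquiv C q).2; have := u.2; nlinarith⟩ := by
  show chunkVec (nQry C) m (splitVec (Tt * (m + m)) _ (splitVec K _ (splitVec 1 _ (splitVec K _ v).2).2).2).2 (qryEquiv C q) u = _
  rw [chunkVec_apply, splitVec_snd, splitVec_snd, splitVec_snd, splitVec_snd]
  congr 1
  exact Fin.ext (by simp [Fin.natAdd]; ring)

end Bridge

/-! ### The residue components are the `val`s of the structured tape -/

section Vals

variable {p : ℕ} [hp : Fact p.Prime] {K m : ℕ} (C : CSP (ZMod p) K m) (Tt b : ℕ) (ρ : List Bool)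

/-- `p ≠ 0` (instance form, from primality). [folklore] -/
instance neZero_of_fact_prime' : NeZero p := ⟨hp.out.ne_zero⟩

local notation "k" => nTape C Tt
local notation "τ" => tapeEquiv C Tt (PCPCoins.dec p b (nTape C Tt) ρ)
local notation "tv" => Prod.snd (coinParse b p (nTape C Tt) ρ)

/-- `ρ`. [folklore] -/
theorem val_rho (t : Fin K) : ((τ).ρ t).val = (rhoN K tv).getD (t : ℕ) 0 := by
  rw [tapeEquiv_rho, val_dec, rhoN, List.getD_eq_getElem?_getD, List.getD_eq_getElem?_getD, List.getElem?_take_of_lt t.2]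

/-- The seed. [folklore] -/
theorem val_seed : (τ).seed.val = seedN K tv := by
  rw [tapeEquiv_seed, val_dec, seedN]

/-- `r`. [folklore] -/
theorem val_r (t : Fin K) : ((τ).r t).val = (rN K tv).getD (t : ℕ) 0 := by
  rw [tapeEquiv_r, val_dec, rN, List.getD_eq_getElem?_getD, List.getD_eq_getElem?_getD, List.getElem?_take_of_lt t.2,
    List.getElem?_drop]

/-- Base points of the tests. [folklore] -/
theorem val_testX (i : Fin Tt) (u : Fin m) : (((τ).tests i).1 u).val = (testX K m tv i).getD (u : ℕ) 0 := by
  rw [tapeEquiv_testX, val_dec, testX, List.getD_eq_getElem?_getD, List.getD_eq_getElem?_getD, List.getElem?_take_of_lt u.2,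
    List.getElem?_drop]

/-- Directions of the tests. [folklore] -/
theorem val_testT (i : Fin Tt) (u : Fin m) : (((τ).tests i).2 u).val = (testT K m tv i).getD (u : ℕ) 0 := by
  rw [tapeEquiv_testT, val_dec, testT, List.getD_eq_getElem?_getD, List.getD_eq_getElem?_getD, List.getElem?_take_of_lt u.2,
    List.getElem?_drop]

/-- Directions of the reads. [folklore] -/
theorem val_dirs (q : C.Qry) (u : Fin m) : ((τ).dirs q u).val = (dirN K m Tt tv (qryEquiv C q)).getD (u : ℕ) 0 := by
  rw [tapeEquiv_dirs, val_dec, dirN, List.getD_eq_getElem?_getD, List.getD_eq_getElem?_getD, List.getElem?_take_of_lt u.2,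
    List.getElem?_drop]

end Vals

/-! ### The programmes -/

section FP

/-- `rhoN` off `(1ᴷ, tv)`. [folklore] -/
theorem rhoNC : CodeFP (pairE unE (rawE natE)) (rawE natE) (fun t => rhoN t.1 t.2) := rawTakeUn natE

/-- `seedN` off `(1ᴷ, tv)`. [folklore] -/
theorem seedNC : CodeFP (pairE unE (rawE natE)) natE (fun t => seedN t.1 t.2) :=
  (rawGetD natE natE_zero).comp ((CodeFP.snd _ _).pair (natOfUn.comp (CodeFP.fst _ _)))

/-- `rN` off `(1ᴷ, tv)`. [folklore] -/
theorem rNC : CodeFP (pairE unE (rawE natE)) (rawE natE) (fun t => rN t.1 t.2) :=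
  (rawTakeUn natE).comp ((CodeFP.fst _ _).pair ((rawDropUn natE).comp ((unSucc.comp (CodeFP.fst _ _)).pair (CodeFP.snd _ _))))

/-- `drop` by a binary count (through the capped unary conversion). [folklore] -/
theorem rawDropNat' {α : Type} (eα : α → List Bool) : CodeFP (pairE natE (rawE eα)) (rawE eα) (fun t => t.2.drop t.1) := by
  have hu : CodeFP (pairE natE (rawE eα)) unE (fun t => min t.1 t.2.length) :=
    unOfNatMin.comp (((ulength eα).comp (CodeFP.snd _ _)).pair (CodeFP.fst _ _))
  refine (((rawDropUn eα).comp (hu.pair (CodeFP.snd _ _)))).congr fun t => ?_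
  dsimp only
  rcases le_total t.1 t.2.length with h | h
  · rw [min_eq_left h]
  · rw [min_eq_right h, List.drop_eq_nil_of_le h, List.drop_eq_nil_of_le le_rfl]

/-- `testX` off `((1ᴷ, 1ᵐ), (tv, i))`. [folklore] -/
theorem testXC : CodeFP (pairE (pairE unE unE) (pairE (rawE natE) natE)) (rawE natE) (fun t => testX t.1.1 t.1.2 t.2.1 t.2.2) := by
  have hK : CodeFP (pairE (pairE unE unE) (pairE (rawE natE) natE)) natE (fun t => t.1.1) := natOfUn.comp (CodeFP.fst _ _).fst'
  have hm : CodeFP (pairE (pairE unE unE) (pairE (rawE natE) natE)) natE (fun t => t.1.2) := natOfUn.comp (CodeFP.fst _ _).snd'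
  have hoff : CodeFP (pairE (pairE unE unE) (pairE (rawE natE) natE)) natE (fun t => t.1.1 + 1 + t.1.1 + (t.1.2 + t.1.2) * t.2.2) :=
    natAdd.comp ((natAdd.comp ((natAdd.comp (hK.pair (CodeFP.const _ 1))).pair hK)).pair (natMul.comp ((natAdd.comp (hm.pair hm)).pair
      (CodeFP.snd _ _).snd')))
  exact (rawTakeUn natE).comp ((CodeFP.fst _ _).snd'.pair ((rawDropNat' natE).comp (hoff.pair (CodeFP.snd _ _).fst')))

/-- `testT` off `((1ᴷ, 1ᵐ), (tv, i))`. [folklore] -/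
theorem testTC : CodeFP (pairE (pairE unE unE) (pairE (rawE natE) natE)) (rawE natE) (fun t => testT t.1.1 t.1.2 t.2.1 t.2.2) := by
  have hK : CodeFP (pairE (pairE unE unE) (pairE (rawE natE) natE)) natE (fun t => t.1.1) := natOfUn.comp (CodeFP.fst _ _).fst'
  have hm : CodeFP (pairE (pairE unE unE) (pairE (rawE natE) natE)) natE (fun t => t.1.2) := natOfUn.comp (CodeFP.fst _ _).snd'
  have hoff : CodeFP (pairE (pairE unE unE) (pairE (rawE natE) natE)) natE (fun t => t.1.1 + 1 + t.1.1 + (t.1.2 + t.1.2) * t.2.2 + t.1.2) :=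
    natAdd.comp ((natAdd.comp ((natAdd.comp ((natAdd.comp (hK.pair (CodeFP.const _ 1))).pair hK)).pair (natMul.comp ((natAdd.comp
      (hm.pair hm)).pair (CodeFP.snd _ _).snd')))).pair hm)
  exact (rawTakeUn natE).comp ((CodeFP.fst _ _).snd'.pair ((rawDropNat' natE).comp (hoff.pair (CodeFP.snd _ _).fst')))

/-- `dirN` off `((1ᴷ, 1ᵐ, 1^{Tt}), (tv, q))`. [folklore] -/
theorem dirNC : CodeFP (pairE (pairE unE (pairE unE unE)) (pairE (rawE natE) natE)) (rawE natE)
    (fun t => dirN t.1.1 t.1.2.1 t.1.2.2 t.2.1 t.2.2) := by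
  have hK : CodeFP (pairE (pairE unE (pairE unE unE)) (pairE (rawE natE) natE)) natE (fun t => t.1.1) := natOfUn.comp (CodeFP.fst _ _).fst'
  have hm : CodeFP (pairE (pairE unE (pairE unE unE)) (pairE (rawE natE) natE)) natE (fun t => t.1.2.1) := natOfUn.comp (CodeFP.fst _ _).snd'.fst'
  have hT : CodeFP (pairE (pairE unE (pairE unE unE)) (pairE (rawE natE) natE)) natE (fun t => t.1.2.2) := natOfUn.comp (CodeFP.fst _ _).snd'.snd'
  have hoff : CodeFP (pairE (pairE unE (pairE unE unE)) (pairE (rawE natE) natE)) natE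
      (fun t => t.1.1 + 1 + t.1.1 + t.1.2.2 * (t.1.2.1 + t.1.2.1) + t.1.2.1 * t.2.2) :=
    natAdd.comp ((natAdd.comp ((natAdd.comp ((natAdd.comp (hK.pair (CodeFP.const _ 1))).pair hK)).pair (natMul.comp (hT.pair
      (natAdd.comp (hm.pair hm)))))).pair (natMul.comp (hm.pair (CodeFP.snd _ _).snd')))
  exact (rawTakeUn natE).comp ((CodeFP.fst _ _).snd'.fst'.pair ((rawDropNat' natE).comp (hoff.pair (CodeFP.snd _ _).fst')))

end FP

/-! ### Unary numerals of the loop bounds (all below `2000 · U(n)⁷`) -/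

section Budgets

variable (M : TM2ComputableAux Bool Bool) (T : ℕ → ℕ) (hTc : CodeFP unE natE T) (cT : ℕ) (hTb : ∀ n, T n ≤ 2 ^ (cT * n + cT))

local notation "d" => dM M

/-- The master unary budget `2000 · U(n)⁷`. [folklore] -/
def WW (n : ℕ) : ℕ := 2000 * UU M cT n ^ 7

/-- `40 ≤ U(n)`. [folklore] -/
theorem forty_le_UU (n : ℕ) : 40 ≤ UU M cT n := by
  unfold UU c0; nlinarith

include hTb in
/-- **All loop bounds of the verifier are below the budget**: `K`, `m`, `d + 2`, `D + 1`, `Tt`,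
`2n + c_Q`, `kF`, `p`, `b₀`, `bN` are `≤ 2000 · U(n)⁷`. [cite: BFLS1991, §5] -/
theorem params_le_WW (n : ℕ) :
    KN M T n ≤ WW M cT n ∧ mN M T n ≤ WW M cT n ∧ dN M T n + 2 ≤ WW M cT n ∧ DN M T n + 1 ≤ WW M cT n ∧
    TtN M T n ≤ WW M cT n ∧ 2 * n + cQ M ≤ WW M cT n ∧ kF M T n ≤ WW M cT n ∧ pN M T n ≤ WW M cT n ∧
    b0 M T n ≤ WW M cT n ∧ bN M T n ≤ WW M cT n := by
  obtain ⟨hcU, hU1⟩ := c0_le_UU M cT n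
  have h40 := forty_le_UU M cT n
  set U := UU M cT n with hUdef
  have hh := hN_le_UU M cT n
  have hkt := ktN_le_UU M T cT hTb n
  have hkJ := kJN_le_UU M T cT hTb n
  have hB := BN_le M T cT hTb n
  rw [← hUdef] at hh hkt hkJ hB
  have hc0 : 2 * d + 3 ≤ U ∧ 2 * n + cQ M ≤ U := by
    have e0 : c0 M cT = cT + 4 * dM M + 8 * cQ M + Nat.card (Val M.tm) + cN M + 20 := rfl
    refine ⟨by omega, ?_⟩
    have e1 : U = c0 M cT * (n + 2) := by rw [hUdef]; rfl
    have e2 : (2 + cQ M) * (n + 2) ≤ c0 M cT * (n + 2) := Nat.mul_le_mul_right _ (by omega)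
    have e3 : 2 * n + cQ M ≤ (2 + cQ M) * (n + 2) := by nlinarith
    omega
  have hm : mN M T n ≤ 3 * U := by unfold mN mPt LN; dsimp only; omega
  have hK : KN M T n ≤ U * U := by
    unfold KN KIdx LN; dsimp only
    calc ktN M T n + ktN M T n + (2 * d + 1) * kJN M T n ≤ U + U + (2 * d + 1) * U :=
          Nat.add_le_add (by omega) (Nat.mul_le_mul_left _ hkJ)
      _ = (2 * d + 3) * U := by ring
      _ ≤ U * U := Nat.mul_le_mul_right _ hc0.1
  have hdN : dN M T n ≤ 3 * U * U := by unfold dN; exact Nat.mul_le_mul hm (by omega)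
  have hU7 : U ^ 7 = U * U * (U * U) * (U * U) * U := by ring
  have hUU : U * U ≤ U ^ 7 := by
    calc U * U = U ^ 2 := by ring
      _ ≤ U ^ 7 := Nat.pow_le_pow_right hU1 (by norm_num)
  have hU17 : U ≤ U ^ 7 := by
    calc U = U ^ 1 := (pow_one U).symm
      _ ≤ U ^ 7 := Nat.pow_le_pow_right hU1 (by norm_num)
  have hU47 : U * U * (U * U) ≤ U ^ 7 := by
    calc U * U * (U * U) = U ^ 4 := by ring
      _ ≤ U ^ 7 := Nat.pow_le_pow_right hU1 (by norm_num)
  have hTt : TtN M T n ≤ 176 * (U * U) * (U * U) := by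
    unfold TtN
    have hUU1 : 1 ≤ U * U := Nat.one_le_iff_ne_zero.2 (by positivity)
    have e1 : (dN M T n + 1) * (2 * dN M T n + 5) ≤ (3 * (U * U) + 1) * (6 * (U * U) + 5) :=
      Nat.mul_le_mul (by linarith) (by linarith)
    have e2 : (3 * (U * U) + 1) * (6 * (U * U) + 5) ≤ 44 * ((U * U) * (U * U)) := by
      set a := U * U
      nlinarith
    linarith
  have hDb : DN M T n ≤ 7 * U ^ 5 := by
    -- as in `BN_le`
    have hA : 3 * ktN M T n + (4 * d + 2) * kJN M T n ≤ (4 * d + 5) * U := by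
      calc 3 * ktN M T n + (4 * d + 2) * kJN M T n ≤ 3 * U + (4 * d + 2) * U :=
            Nat.add_le_add (by omega) (Nat.mul_le_mul_left _ hkJ)
        _ = (4 * d + 5) * U := by ring
    have h45 : 4 * d + 5 ≤ U := by
      have : c0 M cT = cT + 4 * dM M + 8 * cQ M + Nat.card (Val M.tm) + cN M + 20 := rfl
      omega
    have hdeg : degBound M (LN M T n) ≤ 2 * (U * U * U) := by
      unfold degBound LN; dsimp only
      have h1 : (3 * ktN M T n + (4 * d + 2) * kJN M T n) * (hN M n - 1) ≤ ((4 * d + 5) * U) * U := Nat.mul_le_mul hA (by omega)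
      have h2 : ((4 * d + 5) * U) * U ≤ U * U * U := Nat.mul_le_mul_right _ (Nat.mul_le_mul_right _ h45)
      have h3 : Nat.card (Val M.tm) + 3 * d + 3 ≤ U := by
        have : c0 M cT = cT + 4 * dM M + 8 * cQ M + Nat.card (Val M.tm) + cN M + 20 := rfl
        omega
      have h4 : U ≤ U * U * U := by nlinarith
      linarith
    have hprod : degBound M (LN M T n) * dN M T n ≤ 2 * (U * U * U) * (3 * U * U) := Nat.mul_le_mul hdeg hdN
    have hU5 : U ≤ U ^ 5 := by calc U = U ^ 1 := (pow_one U).symm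
      _ ≤ U ^ 5 := Nat.pow_le_pow_right hU1 (by norm_num)
    unfold DN
    have e : 2 * (U * U * U) * (3 * U * U) + U ^ 5 = 7 * U ^ 5 := by ring
    rw [← e]
    exact Nat.add_le_add hprod (le_trans (by omega) hU5)
  have hU5le : U ^ 5 ≤ U ^ 7 := Nat.pow_le_pow_right hU1 (by norm_num)
  have hkF : kF M T n ≤ 1100 * U ^ 7 := by
    rw [kF_formula]
    have h1 : TtN M T n * (mN M T n + mN M T n) ≤ 176 * (U * U) * (U * U) * (6 * U) := Nat.mul_le_mul hTt (by omega)
    have h2 : (2 * n + cQ M) * mN M T n ≤ U * (3 * U) := Nat.mul_le_mul hc0.2 hm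
    have h3 : 176 * (U * U) * (U * U) * (6 * U) ≤ 1056 * U ^ 7 := by
      have e : 176 * (U * U) * (U * U) * (6 * U) = 1056 * (U ^ 5) := by ring
      rw [e]; exact Nat.mul_le_mul_left _ (Nat.pow_le_pow_right hU1 (by norm_num))
    have h4 : U * (3 * U) ≤ 3 * U ^ 7 := by
      have e : U * (3 * U) = 3 * (U * U) := by ring
      rw [e]; exact Nat.mul_le_mul_left _ hUU
    have h5 := hK.trans hUU
    linarith
  have hp : pN M T n ≤ 420 * U ^ 7 := (pN_le M T n).trans (by omega)
  have hp0 : pN M T n ≠ 0 := by have := two_le_pN M T n; omega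
  have hb0 : b0 M T n ≤ pN M T n := by
    unfold b0
    exact Nat.succ_le_of_lt (Nat.log_lt_self 2 hp0)
  have hlogkF : Nat.log 2 (kF M T n) ≤ kF M T n := Nat.log_le_self 2 _
  have hbN : bN M T n ≤ pN M T n + kF M T n + 6 := by
    unfold bN
    have := Nat.log_lt_self 2 hp0
    omega
  have hU71 : 1 ≤ U ^ 7 := Nat.one_le_pow _ _ hU1
  unfold WW
  refine ⟨by linarith, by linarith, by linarith, by linarith, by linarith, by linarith, by linarith, by linarith, by linarith, by linarith⟩

/-- **The master budget off `1ⁿ`** (unary). [folklore] -/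
theorem WWC : CodeFP unE unE (WW M cT) := by
  have hU : CodeFP unE unE (UU M cT) :=
    ((unMulConst (c0 M cT)).comp (unSucc.comp unSucc)).congr fun n => by unfold UU; ring
  exact ((unMulConst 2000).comp (((ulength unitE).comp (unitsPow 7)).comp hU)).congr fun n => by simp [WW]

/-- **A binary parameter below the budget, as a unary numeral.** [folklore] -/
theorem unaryOf {f : ℕ → ℕ} (hf : CodeFP unE natE f) (hle : ∀ n, f n ≤ WW M cT n) : CodeFP unE unE f :=
  (unOfNatMin.comp ((WWC M cT).pair hf)).congr fun n => min_eq_left (hle n)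

include hTc hTb in
/-- `K` in unary. [folklore] -/
theorem KNU : CodeFP unE unE (KN M T) := unaryOf M cT (KNC M T hTc) fun n => (params_le_WW M T cT hTb n).1

include hTc hTb in
/-- `m` in unary. [folklore] -/
theorem mNU : CodeFP unE unE (mN M T) := unaryOf M cT (mNC M T hTc) fun n => (params_le_WW M T cT hTb n).2.1

include hTc hTb in
/-- `d + 2` in unary. [folklore] -/
theorem dN2U : CodeFP unE unE (fun n => dN M T n + 2) :=
  unaryOf M cT (natAdd.comp ((dNC M T hTc).pair (CodeFP.const _ 2))) fun n => (params_le_WW M T cT hTb n).2.2.1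

include hTc hTb in
/-- `D + 1` in unary. [folklore] -/
theorem DN1U : CodeFP unE unE (fun n => DN M T n + 1) :=
  unaryOf M cT (natAdd.comp ((DNC M T hTc).pair (CodeFP.const _ 1))) fun n => (params_le_WW M T cT hTb n).2.2.2.1

include hTc hTb in
/-- `Tt` in unary. [folklore] -/
theorem TtNU : CodeFP unE unE (TtN M T) := unaryOf M cT (TtNC M T hTc) fun n => (params_le_WW M T cT hTb n).2.2.2.2.1

include hTb in
/-- `2n + c_Q` (the number of reads) in unary. [folklore] -/
theorem nQryU : CodeFP unE unE (fun n => 2 * n + cQ M) :=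
  unaryOf M cT (natAdd.comp ((natMul.comp ((CodeFP.const _ 2).pair nC)).pair (CodeFP.const _ (cQ M))))
    fun n => (params_le_WW M T cT hTb n).2.2.2.2.2.1

include hTc hTb in
/-- `kF` in unary. [folklore] -/
theorem kFU : CodeFP unE unE (kF M T) := unaryOf M cT (kFC M T hTc) fun n => (params_le_WW M T cT hTb n).2.2.2.2.2.2.1

include hTc hTb in
/-- `b₀` in unary. [folklore] -/
theorem b0U : CodeFP unE unE (b0 M T) := unaryOf M cT (b0C M T hTc cT hTb) fun n => (params_le_WW M T cT hTb n).2.2.2.2.2.2.2.2.1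

include hTc hTb in
/-- `bN` in unary. [folklore] -/
theorem bNU : CodeFP unE unE (bN M T) := unaryOf M cT (bNC M T hTc cT hTb) fun n => (params_le_WW M T cT hTb n).2.2.2.2.2.2.2.2.2

end Budgets

end ScaledPCP

end Literature.Computability.Complexity

end
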